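import Summits.AtomisticToContinuum.Crystallization.Theorems.ChessboardParticlePlanesPeriodicWindowsStubGapSqueeze

/-!
# Crux `PeriodicWindows` (stmt-AtomisticToContinuum-3240), line `dense-laminar-hull` — stub HC, helper
# `hc_templateOfHollow`: hollow consecutive offsets make the layered set a Barlow-type template

Bookkeeping between the hollow closing (HC) and the pinning step. Let `{i v₁(a) + j v₂(a) + δ m + z m e₃}` be a general
layered set with `δ 0 = 0` whose consecutive offsets are hollow vectors up to the layer lattice,
`δ (m+1) - δ m = s_m • barlowOffset a + i_m v₁ + j_m v₂` with `s_m = ±1`. Then `s` is a Hägg word and, with the layer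
labels `L = haggLabel s` (`L 0 = 0`, `L (m+1) = L m + s m`), one has `δ m - (L m) • barlowOffset a ∈ ℤ v₁ + ℤ v₂` for every
`m` (induction up and down from `m = 0`, `hct_offset_eq_label`); a layer-lattice translate of the offset of layer `m` is
absorbed by re-indexing the sites `(i, j)` of that layer, so the layered set coincides (after any map `B`, and the trivial
translation `+ 0`) with the template `{i v₁ + j v₂ + (L m) • barlowOffset a + z m e₃}` coded by `s`. All elementary.
[folklore]
-/

noncomputable section

namespace Summit.AtomisticToContinuum.Crystallization.Theorems.PeriodicWindowsDenseLaminarHull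

open Literature.MathematicalPhysics.StatisticalMechanics Filter Metric
open scoped BigOperators

/-- **Offsets of a hollow-stacked layered set are the template offsets up to the layer lattice.** If `δ 0 = 0` and
`δ (m+1) - δ m = (s m) • b + (u m) • v₁ + (v m) • v₂` for every `m`, then
`δ m = (haggLabel s m) • b + c₁ • v₁ + c₂ • v₂` for some integers `c₁, c₂` (induction up and down from `0` with
`haggLabel_zero`, `haggLabel_succ`). [folklore] -/
theorem hct_offset_eq_label {a : ℝ} {δ : ℤ → EuclideanSpace ℝ (Fin 3)} {s u v : ℤ → ℤ} (hδ0 : δ 0 = 0)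
    (hd : ∀ m : ℤ, δ (m + 1) - δ m =
      (s m : ℝ) • barlowOffset a + (u m : ℝ) • triangularVec₁ a + (v m : ℝ) • triangularVec₂ a) (m : ℤ) :
    ∃ c₁ c₂ : ℤ, δ m = (haggLabel s m : ℝ) • barlowOffset a +
      (c₁ : ℝ) • triangularVec₁ a + (c₂ : ℝ) • triangularVec₂ a := by
  -- one step up
  have up : ∀ m : ℤ, (∃ c₁ c₂ : ℤ, δ m = (haggLabel s m : ℝ) • barlowOffset a +
      (c₁ : ℝ) • triangularVec₁ a + (c₂ : ℝ) • triangularVec₂ a) →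
      ∃ c₁ c₂ : ℤ, δ (m + 1) = (haggLabel s (m + 1) : ℝ) • barlowOffset a +
        (c₁ : ℝ) • triangularVec₁ a + (c₂ : ℝ) • triangularVec₂ a := by
    rintro m ⟨c₁, c₂, hm⟩
    refine ⟨c₁ + u m, c₂ + v m, ?_⟩
    have e : δ (m + 1) = δ m + (δ (m + 1) - δ m) := (add_sub_cancel (δ m) (δ (m + 1))).symm
    rw [e, hd m, hm, haggLabel_succ]
    push_cast
    module
  -- one step down
  have down : ∀ m : ℤ, (∃ c₁ c₂ : ℤ, δ (m + 1) = (haggLabel s (m + 1) : ℝ) • barlowOffset a +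
      (c₁ : ℝ) • triangularVec₁ a + (c₂ : ℝ) • triangularVec₂ a) →
      ∃ c₁ c₂ : ℤ, δ m = (haggLabel s m : ℝ) • barlowOffset a +
        (c₁ : ℝ) • triangularVec₁ a + (c₂ : ℝ) • triangularVec₂ a := by
    rintro m ⟨c₁, c₂, hm⟩
    refine ⟨c₁ - u m, c₂ - v m, ?_⟩
    have e : δ m = δ (m + 1) - (δ (m + 1) - δ m) := (sub_sub_cancel (δ (m + 1)) (δ m)).symm
    rw [e, hd m, hm, haggLabel_succ]
    push_cast
    module
  induction m with
  | zero => exact ⟨0, 0, by simp [hδ0]⟩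
  | succ k ih => exact up k ih
  | pred k ih =>
    apply down
    rw [sub_add_cancel]
    exact ih

/-- **STUB HC helper `hc_templateOfHollow` (hollow offsets ⇒ Barlow-type template).** If `δ 0 = 0` and every
consecutive offset of the general layered set `{i v₁(a) + j v₂(a) + δ m + z m e₃}` is a hollow vector up to the layer
lattice, `δ (m+1) - δ m = s_m • barlowOffset a + i_m v₁ + j_m v₂` with `s_m = ±1`, then `s` is a Hägg word and the
layered set is (after `B`, and up to the trivial translation `+ 0`) the Barlow-type template
`{i v₁ + j v₂ + (haggLabel s m) • barlowOffset a + z m e₃}`: by `hct_offset_eq_label` every `δ m` is the template offset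
plus a layer-lattice vector, which is absorbed by re-indexing `(i, j)` layer by layer. [folklore] -/
theorem hc_templateOfHollow : ∀ a : ℝ, 0 < a →
    ∀ (B : EuclideanSpace ℝ (Fin 3) ≃ₗᵢ[ℝ] EuclideanSpace ℝ (Fin 3)) (δ : ℤ → EuclideanSpace ℝ (Fin 3)) (z : ℤ → ℝ),
    (∀ m : ℤ, (δ m) 2 = 0) → δ 0 = 0 →
    (∀ m : ℤ, ∃ s i j : ℤ, (s = 1 ∨ s = -1) ∧ δ (m + 1) - δ m =
      (s : ℝ) • barlowOffset a + (i : ℝ) • triangularVec₁ a + (j : ℝ) • triangularVec₂ a) →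
    ∃ s : ℤ → ℤ, IsHaggSeq s ∧
      (fun p => B p) '' {p | ∃ m i j : ℤ, p = ((i : ℝ) • triangularVec₁ a) +
          ((j : ℝ) • triangularVec₂ a) + δ m + (z m • layerNormal 1)} =
        (fun p => B p + (0 : EuclideanSpace ℝ (Fin 3))) '' {p | ∃ m i j : ℤ, p = ((i : ℝ) • triangularVec₁ a) +
          ((j : ℝ) • triangularVec₂ a) + ((haggLabel s m : ℝ) • barlowOffset a) + (z m • layerNormal 1)} := by
  intro a _ha B δ z _hδ hδ0 h
  choose s u v hs hd using h
  refine ⟨s, hs, ?_⟩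
  -- every offset is the template offset up to a layer-lattice vector
  choose c₁ c₂ hc using hct_offset_eq_label hδ0 hd
  ext q
  constructor
  · rintro ⟨p, ⟨m, i, j, rfl⟩, rfl⟩
    refine ⟨_, ⟨m, i + c₁ m, j + c₂ m, rfl⟩, ?_⟩
    dsimp only
    rw [add_zero, hc m]
    congr 1
    push_cast
    module
  · rintro ⟨p, ⟨m, i, j, rfl⟩, rfl⟩
    refine ⟨_, ⟨m, i - c₁ m, j - c₂ m, rfl⟩, ?_⟩
    dsimp only
    rw [add_zero, hc m]
    congr 1
    push_cast
    module

end Summit.AtomisticToContinuum.Crystallization.Theorems.PeriodicWindowsDenseLaminarHull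

end
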